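import Literature.Barriers.RiemannHypothesis.DavenportHeilbronnDegreeTwoBTProp9
import Literature.Barriers.RiemannHypothesis.DavenportHeilbronnDegreeTwoBTProp10
import Literature.Barriers.RiemannHypothesis.DavenportHeilbronnDegreeTwoBTEuler
import Literature.Barriers.RiemannHypothesis.DavenportHeilbronnDegreeTwoTwistedZeros
import Literature.NumberTheory.EllipticCurves.DeligneHeckeEigenvalueBoundProofs
import Literature.NumberTheory.LFunctions.PrimeReciprocalAP
import Mathlib.NumberTheory.SumPrimeReciprocals
import HarnessLib

/-!
# Booker–Thorne 2014 at level one: Proposition 8, §4 step (1), and `BookerThorne2014_levelOne_zeros`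
# granted Deligne's bound and Lemma 3

Sibling of `DavenportHeilbronnDegreeTwo.lean` (barrier catalogue, D-0021); everything here is
PROVED, there are no definitions and no named facts.

A. R. Booker, F. Thorne, *Zeros of `L`-functions outside the critical strip*, Algebra Number
Theory 8 (2014), 2027–2042 (arXiv:1306.6362, read in full). The catalogued fact
`Literature.Barriers.RiemannHypothesis.BookerThorne2014_levelOne_zeros` (Theorem 1 with §1,
Remark 2, at level one) is Theorem 2 for the `π_{g}` of the level-one newforms and a linear
polynomial; its printed proof consists of

* **Proposition 9** (compactness + Brouwer on a polydisc) — tree: `BookerThorne2014.prop9`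
  (`DavenportHeilbronnDegreeTwoBTProp9.lean`);
* **Proposition 10** (partition of the primes `Y < p ≤ P` into classes with well-conditioned
  phased class sums, from Lemma 3) — tree: `BookerThorne2014.abstract_prop10`
  (`DavenportHeilbronnDegreeTwoBTProp10.lean`, the abstract statement over weighted vectors
  `Λ_p` with a Gram lower bound);
* **Proposition 8** ("for `σ ∈ (1, 1 + η]` there are `y` and `t_p` with
  `∏_{p > y} L(σ + it_p, π_{j,p}) = z_j`", proof: linearise `log L_p`, main term
  `∑_i ∑_k G_{ik} f_i(μ⁻¹ z)_k = z` by Props. 9–10, error `O(1)` absorbed by Brouwer's theorem on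
  `(C + R')D`) — THIS FILE, `BookerThorne2014.exists_twist_eq_exp_target`, for the local factors
  `(1 − a_g(p) e(p) p^{-s} + p^{k−1} e(p)² p^{-2s})⁻¹` of a level-one newform at `s = σ + (k−1)/2`
  (`DavenportHeilbronnDegreeTwoBTEuler.lean`), the primes `p ≤ Y` and `p > P` carrying the
  trivial phase (their logarithms are part of the `O(1)` error, as in the printed "we may take
  `t_p = 0` for `p ≤ y`");
* **§4, step (1)** for `P = ∑ c_g x_g` (Lemma 7 is trivial for linear `P`: a zero with all
  coordinates non-zero) — THIS FILE, `BookerThorne2014.levelOne_twistedZeros_of_prop8`;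
* **§4, step (2)** (Kronecker/Rouché, `≫ T` zeros) and the passage to `Λ_f` — tree:
  `BookerThorne2014_levelOne_zeros_of_twistedZeros` (`DavenportHeilbronnDegreeTwoTwistedZeros.lean`).

The two inputs of the printed proof that the tree does not prove are kept as hypotheses of the
final theorem `BookerThorne2014_levelOne_zeros_of_deligne_of_lemma3`: the Ramanujan bound at every
prime (Deligne's theorem, the tree's named fact
`Literature.NumberTheory.EllipticCurves.ModularForms.Deligne1974_heckeT_eigenvalue_norm_le`) and
Booker–Thorne's Lemma 3 (quasi-orthogonality of Hecke eigenvalues over primes in progressions,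
from Liu–Ye's Selberg orthogonality for Rankin–Selberg `L`-functions), stated verbatim for the
`π_g` of distinct level-one newforms as the binder `hL3` (it is NOT introduced as a named fact).

Conventions: sums over primes `p > y` are `∑' n : ℕ` of a summand supported on the primes
(as in `Literature.NumberTheory.LFunctions.exists_forall_le_tsum_prime_residue_rpow`, the prime
number theorem input "`s(Y, σ) → ∞` as `σ → 1⁺`"); vectors `z ∈ ℂⁿ` carry the sup norm
(`Fin n → ℂ`), the `Λ_p` the Euclidean norm (`EuclideanSpace ℂ (Fin n)`).

## References

* [BookerThorne2014] A. R. Booker, F. Thorne, Algebra Number Theory 8 (2014), 2027–2042: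
  Thm. 1, §1 Rem. 2, §2.1 (Lemma 3), §3 (Props. 8, 9, 10 and their proofs), §4 (arXiv:1306.6362).
* [Deligne1974] P. Deligne, *La conjecture de Weil. I*, Publ. Math. IHÉS 43 (1974), Thm. 8.2.
* [LiuYe2005] J. Liu, Y. Ye, *Weighted Selberg orthogonality and uniqueness of factorization of
  automorphic `L`-functions*, Forum Math. 17 (2005), 493–512 (input of the printed Lemma 3).
-/

noncomputable section

open Finset Filter Topology Complex
open scoped InnerProductSpace ComplexConjugate Matrix

namespace Literature.Barriers.RiemannHypothesis

namespace BookerThorne2014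

/-! ### G1. The vectors `Λ_p` -/

/-- The Euclidean norm of a vector with entries of modulus `≤ 2` is at most `2√n`. [folklore] -/
theorem norm_toLp_le_of_forall_le {n : ℕ} {v : Fin n → ℂ} {B : ℝ} (hB : 0 ≤ B)
    (hv : ∀ i, ‖v i‖ ≤ B) : ‖(WithLp.toLp 2 v : EuclideanSpace ℂ (Fin n))‖ ≤ B * Real.sqrt n := by
  rw [EuclideanSpace.norm_eq]
  have h : ∑ i, ‖(WithLp.toLp 2 v : EuclideanSpace ℂ (Fin n)) i‖ ^ 2 ≤ n * B ^ 2 := by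
    calc ∑ i, ‖(WithLp.toLp 2 v : EuclideanSpace ℂ (Fin n)) i‖ ^ 2 ≤ ∑ _i : Fin n, B ^ 2 :=
          Finset.sum_le_sum fun i _ ↦ by
            rw [PiLp.toLp_apply]
            exact pow_le_pow_left₀ (norm_nonneg _) (hv i) 2
      _ = n * B ^ 2 := by simp
  calc Real.sqrt (∑ i, ‖(WithLp.toLp 2 v : EuclideanSpace ℂ (Fin n)) i‖ ^ 2)
      ≤ Real.sqrt (n * B ^ 2) := Real.sqrt_le_sqrt h
    _ = B * Real.sqrt n := by
        rw [Real.sqrt_mul (Nat.cast_nonneg n), Real.sqrt_sq hB, mul_comm]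

/-- `⟪u, Λ⟫ = ∑_i conj(u_i) Λ_i` on `ℂⁿ`; with `u' = conj ∘ u` this is `∑ u'_i Λ_i`, and `u'` is a
unit vector when `u` is. [folklore] -/
theorem inner_toLp_eq_sum {n : ℕ} (u : EuclideanSpace ℂ (Fin n)) (v : Fin n → ℂ) :
    ⟪u, (WithLp.toLp 2 v : EuclideanSpace ℂ (Fin n))⟫_ℂ = ∑ i, conj (u i) * v i := by
  simp [PiLp.inner_apply, mul_comm]

/-- The conjugate of a unit vector is a unit vector (in coordinates). [folklore] -/
theorem sum_norm_conj_sq_eq {n : ℕ} (u : EuclideanSpace ℂ (Fin n)) (hu : ‖u‖ = 1) :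
    ∑ i, ‖conj (u i)‖ ^ 2 = 1 := by
  have h := EuclideanSpace.norm_eq u
  rw [hu] at h
  have h2 : ∑ i, ‖u i‖ ^ 2 = 1 := by
    have := congrArg (fun x : ℝ ↦ x ^ 2) h
    simp only [one_pow] at this
    rw [Real.sq_sqrt (Finset.sum_nonneg fun _ _ ↦ by positivity)] at this
    exact this.symm
  simpa only [Complex.norm_conj] using h2

/-- A single Gram term is at most `‖u‖² ‖Λ‖²`-ish: `‖⟪u, Λ⟫‖² ≤ ‖Λ‖²` for a unit `u`.
[folklore] -/
theorem norm_inner_sq_le {n : ℕ} (u Λ : EuclideanSpace ℂ (Fin n)) (hu : ‖u‖ = 1) :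
    ‖⟪u, Λ⟫_ℂ‖ ^ 2 ≤ ‖Λ‖ ^ 2 := by
  have h := norm_inner_le_norm (𝕜 := ℂ) u Λ
  rw [hu, one_mul] at h
  exact pow_le_pow_left₀ (norm_nonneg _) h 2

/-! ### G2. Sums over primes in a window and in a tail -/

/-- Splitting the sum over the primes `p > Y` into the window `Y < p ≤ P` (a finite sum) and the
tail `p > P`. [folklore] -/
theorem tsum_prime_gt_eq_sum_add_tsum {f : ℕ → ℂ} {Y P : ℕ} (hYP : Y ≤ P)
    (hf : Summable fun n : ℕ ↦ if n.Prime ∧ Y < n then f n else 0) :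
    (∑' n : ℕ, if n.Prime ∧ Y < n then f n else 0) =
      ∑ p ∈ (Finset.Ioc Y P).filter Nat.Prime, f p + ∑' n : ℕ, if n.Prime ∧ P < n then f n else 0 := by
  classical
  have hsplit : (fun n : ℕ ↦ if n.Prime ∧ Y < n then f n else 0) = fun n ↦
      (if n ∈ (Finset.Ioc Y P).filter Nat.Prime then f n else 0) +
      (if n.Prime ∧ P < n then f n else 0) := by
    funext n
    simp only [Finset.mem_filter, Finset.mem_Ioc]
    by_cases hp : n.Prime
    · by_cases h1 : Y < n
      · by_cases h2 : n ≤ P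
        · simp [hp, h1, h2, not_lt.2 h2]
        · push Not at h2
          simp [hp, h1, h2, not_le.2 h2]
      · have h3 : ¬ P < n := fun h ↦ h1 (lt_of_le_of_lt hYP h)
        simp [hp, h1, h3]
    · simp [hp]
  have htail : Summable fun n : ℕ ↦ if n.Prime ∧ P < n then f n else 0 := by
    refine Summable.of_norm_bounded hf.norm fun n ↦ ?_
    by_cases h : n.Prime ∧ P < n
    · rw [if_pos h, if_pos ⟨h.1, lt_of_le_of_lt hYP h.2⟩]
    · rw [if_neg h, norm_zero]; positivity
  have hfin : Summable fun n : ℕ ↦ if n ∈ (Finset.Ioc Y P).filter Nat.Prime then f n else 0 :=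
    summable_of_ne_finset_zero (s := (Finset.Ioc Y P).filter Nat.Prime) fun n hn ↦ if_neg hn
  rw [hsplit, Summable.tsum_add hfin htail]
  congr 1
  rw [tsum_eq_sum (s := (Finset.Ioc Y P).filter Nat.Prime) fun n hn ↦ if_neg hn]
  exact Finset.sum_congr rfl fun n hn ↦ if_pos hn

/-- The same splitting for real-valued summands. [folklore] -/
theorem tsum_prime_gt_eq_sum_add_tsum_real {f : ℕ → ℝ} {Y P : ℕ} (hYP : Y ≤ P)
    (hf : Summable fun n : ℕ ↦ if n.Prime ∧ Y < n then f n else 0) :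
    (∑' n : ℕ, if n.Prime ∧ Y < n then f n else 0) =
      ∑ p ∈ (Finset.Ioc Y P).filter Nat.Prime, f p + ∑' n : ℕ, if n.Prime ∧ P < n then f n else 0 := by
  have h := tsum_prime_gt_eq_sum_add_tsum (f := fun n ↦ (f n : ℂ)) hYP ?_
  · have e1 : (∑' n : ℕ, if n.Prime ∧ Y < n then (f n : ℂ) else 0) =
        ((∑' n : ℕ, if n.Prime ∧ Y < n then f n else 0 : ℝ) : ℂ) := by
      rw [Complex.ofReal_tsum]; exact tsum_congr fun n ↦ by split_ifs <;> simp
    have e2 : (∑' n : ℕ, if n.Prime ∧ P < n then (f n : ℂ) else 0) =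
        ((∑' n : ℕ, if n.Prime ∧ P < n then f n else 0 : ℝ) : ℂ) := by
      rw [Complex.ofReal_tsum]; exact tsum_congr fun n ↦ by split_ifs <;> simp
    have e3 : (∑ p ∈ (Finset.Ioc Y P).filter Nat.Prime, (f p : ℂ)) =
        ((∑ p ∈ (Finset.Ioc Y P).filter Nat.Prime, f p : ℝ) : ℂ) := by push_cast; rfl
    rw [e1, e2, e3, ← Complex.ofReal_add] at h
    exact_mod_cast h
  · have := (Complex.ofRealCLM.summable hf)
    refine this.congr fun n ↦ ?_
    simp only [Complex.ofRealCLM_apply]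
    split_ifs <;> simp

/-- **Tails of the prime sums are small**: for a summable `∑_{p > Y} f(p)` (`f ≥ 0`) and `ε > 0`
there is `P ≥ Y` with `∑_{p > P} f(p) < ε`. [folklore] -/
theorem exists_tail_lt {f : ℕ → ℝ} (hf0 : ∀ n, 0 ≤ f n) {Y : ℕ}
    (hf : Summable fun n : ℕ ↦ if n.Prime ∧ Y < n then f n else 0) {ε : ℝ} (hε : 0 < ε) :
    ∃ P : ℕ, Y ≤ P ∧ (∑' n : ℕ, if n.Prime ∧ P < n then f n else 0) < ε := by
  -- the tail beyond `P` is dominated by the tail `∑_{n ≥ P+1}` of the summable sequence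
  set F : ℕ → ℝ := fun n ↦ if n.Prime ∧ Y < n then f n else 0 with hF
  have hF0 : ∀ n, 0 ≤ F n := fun n ↦ by simp only [hF]; split_ifs <;> simp [hf0]
  have htend := (tendsto_order.1 (tendsto_sum_nat_add F)).2 ε hε
  rw [eventually_atTop] at htend
  obtain ⟨N, hN⟩ := htend
  refine ⟨max Y N, le_max_left _ _, ?_⟩
  have hle : ∀ n, (if n.Prime ∧ max Y N < n then f n else 0) ≤ F n := by
    intro n
    by_cases h : n.Prime ∧ max Y N < n
    · rw [if_pos h]
      simp only [hF, if_pos (show n.Prime ∧ Y < n from ⟨h.1, lt_of_le_of_lt (le_max_left _ _) h.2⟩)]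
      rfl
    · rw [if_neg h]; exact hF0 n
  have hzero : ∀ n, n < max Y N + 1 → (if n.Prime ∧ max Y N < n then f n else 0) = 0 := by
    intro n hn
    rw [if_neg]
    rintro ⟨-, h⟩
    omega
  have hsum : Summable fun n ↦ if n.Prime ∧ max Y N < n then f n else 0 :=
    hf.of_nonneg_of_le (fun n ↦ by split_ifs <;> simp [hf0]) hle
  calc (∑' n : ℕ, if n.Prime ∧ max Y N < n then f n else 0)
      = ∑' m : ℕ, (if (m + (max Y N + 1)).Prime ∧ max Y N < m + (max Y N + 1) then
          f (m + (max Y N + 1)) else 0) := by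
        rw [← hsum.sum_add_tsum_nat_add (max Y N + 1)]
        rw [Finset.sum_eq_zero fun n hn ↦ hzero n (Finset.mem_range.1 hn), zero_add]
    _ ≤ ∑' m : ℕ, F (m + (max Y N + 1)) :=
        ((summable_nat_add_iff _).2 hsum).tsum_le_tsum (fun m ↦ hle _) ((summable_nat_add_iff _).2 hf)
    _ < ε := hN (max Y N + 1) (by omega)

/-! ### G3. Sums over `Nat.Primes`, decomposition of the log-sum, the main-term identity -/

/-- A sum over `Nat.Primes` is the sum over `ℕ` of the summand restricted to the primes.
[folklore] -/
theorem tsum_primes_eq_tsum_ite (h : ℕ → ℂ) :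
    ∑' q : Nat.Primes, h q = ∑' n : ℕ, if n.Prime then h n else 0 := by
  rw [show (fun n : ℕ ↦ if n.Prime then h n else 0) = {p : ℕ | p.Prime}.indicator h by
    funext n; rw [Set.indicator_apply]; rfl]
  exact tsum_subtype {p : ℕ | p.Prime} h

/-- The real version. [folklore] -/
theorem tsum_primes_eq_tsum_ite_real (h : ℕ → ℝ) :
    ∑' q : Nat.Primes, h q = ∑' n : ℕ, if n.Prime then h n else 0 := by
  rw [show (fun n : ℕ ↦ if n.Prime then h n else 0) = {p : ℕ | p.Prime}.indicator h by
    funext n; rw [Set.indicator_apply]; rfl]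
  exact tsum_subtype {p : ℕ | p.Prime} h

/-- Summability over `Nat.Primes` versus summability over `ℕ` of the prime-supported summand.
[folklore] -/
theorem summable_ite_prime_of_summable_primes {h : ℕ → ℂ} (hs : Summable fun q : Nat.Primes ↦ h q) :
    Summable fun n : ℕ ↦ if n.Prime then h n else 0 := by
  rw [show (fun n : ℕ ↦ if n.Prime then h n else 0) = {p : ℕ | p.Prime}.indicator h by
    funext n; rw [Set.indicator_apply]; rfl]
  exact summable_subtype_iff_indicator.1 hs

/-- **Decomposition of a sum of local terms over all primes** into the finitely many "phased"
primes of a window `Pw` (a set of primes) and the remaining primes, where the phase is `1`: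
`∑_q L_q(ψ_q) = ∑_{p ∈ Pw} L_p(ψ_p) + ∑_{q prime, q ∉ Pw} L_q(1)` for `ψ = 1` off `Pw`.
[cite: BookerThorne2014, proof of Prop. 8 (primes `p ≤ y` with `t_p = 0`)] -/
theorem tsum_primes_local_eq_sum_add {Pw : Finset ℕ} (hPw : ∀ p ∈ Pw, p.Prime) (L : ℕ → ℂ → ℂ)
    {ψ : ℕ → ℂ} (hψ : ∀ p, p ∉ Pw → ψ p = 1)
    (hsum : Summable fun q : Nat.Primes ↦ L q (ψ q)) :
    ∑' q : Nat.Primes, L q (ψ q) =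
      ∑ p ∈ Pw, L p (ψ p) + ∑' n : ℕ, (if n.Prime ∧ n ∉ Pw then L n 1 else 0) := by
  classical
  rw [tsum_primes_eq_tsum_ite (fun n ↦ L n (ψ n))]
  have hsumN := summable_ite_prime_of_summable_primes (h := fun n ↦ L n (ψ n)) hsum
  have hpt : ∀ n : ℕ, (if n.Prime then L n (ψ n) else 0) =
      (if n ∈ Pw then L n (ψ n) else 0) + (if n.Prime ∧ n ∉ Pw then L n 1 else 0) := by
    intro n
    by_cases hn : n ∈ Pw
    · simp [hn, hPw n hn]
    · by_cases hp : n.Prime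
      · simp [hn, hp, hψ n hn]
      · simp [hn, hp]
  have hfin : Summable fun n : ℕ ↦ if n ∈ Pw then L n (ψ n) else 0 :=
    summable_of_ne_finset_zero (s := Pw) fun n hn ↦ if_neg hn
  have hrest : Summable fun n : ℕ ↦ if n.Prime ∧ n ∉ Pw then L n 1 else 0 := by
    have := hsumN.sub hfin
    refine this.congr fun n ↦ ?_
    rw [hpt n]
    ring
  rw [tsum_congr hpt, Summable.tsum_add hfin hrest]
  congr 1
  rw [tsum_eq_sum (s := Pw) fun n hn ↦ if_neg hn]
  exact Finset.sum_congr rfl fun n hn ↦ if_pos hn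

/-- **The main-term identity, algebraic form** ([BookerThorne2014], proof of Prop. 8:
"`∑_{p>y} λ_j(p) p^{-(σ+it_p(z))} = ∑_i ∑_k ∑_{p ∈ S_{ik}} λ_j(p) ε_p f_i(μ⁻¹z)_k p^{-σ} = z_j`"):
if the entries are the phased class sums, `Gx k = c' ∑_{cls p = (x,k)} ε_p α_p`, then
`∑_{p ∈ Pw} α_p ε_p F_{(cls p)} = c'⁻¹ ∑_x ∑_k Gx k · F x k`.
[cite: BookerThorne2014, proof of Prop. 8] -/
theorem sum_phased_eq_of_class_sums {n : ℕ} {J : Type*} [Fintype J] [DecidableEq J]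
    (Pw : Finset ℕ) (cls : ℕ → J × Fin n) (ε α : ℕ → ℂ) (F : J → Fin n → ℂ)
    (Gent : J → Fin n → ℂ) {c' : ℂ} (hc' : c' ≠ 0)
    (hG : ∀ x k, Gent x k = c' * ∑ p ∈ Pw.filter (fun p ↦ cls p = (x, k)), ε p * α p) :
    ∑ p ∈ Pw, α p * (ε p * F (cls p).1 (cls p).2) = c'⁻¹ * ∑ x, ∑ k, Gent x k * F x k := by
  classical
  have hfib := Finset.sum_fiberwise Pw cls (fun p ↦ α p * (ε p * F (cls p).1 (cls p).2))
  rw [← hfib, Fintype.sum_prod_type, Finset.mul_sum]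
  refine Finset.sum_congr rfl fun x _ ↦ ?_
  rw [Finset.mul_sum]
  refine Finset.sum_congr rfl fun k _ ↦ ?_
  rw [hG x k, ← mul_assoc, ← mul_assoc, inv_mul_cancel₀ hc', one_mul, Finset.sum_mul]
  refine Finset.sum_congr rfl fun p hp ↦ ?_
  rw [Finset.mem_filter] at hp
  rw [hp.2]
  ring

/-- **The main-term identity, matrix form**: if the entries of the `G_x` are the phased class
sums `c ∑_{cls p = (x,k)} ε_p ω_p Λ_p` and `∑_x G_x f_x = z`, then
`∑_{p ∈ Pw} ω_p Λ_{p,i} ε_p f_{(cls p)} = c⁻¹ z_i`. [cite: BookerThorne2014, proof of Prop. 8] -/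
theorem sum_window_linear_eq {n : ℕ} {J : Type*} [Fintype J] [DecidableEq J] (Pw : Finset ℕ)
    (cls : ℕ → J × Fin n) (ε : ℕ → ℂ) (ω : ℕ → ℝ) (Λ : ℕ → EuclideanSpace ℂ (Fin n))
    (G : J → Matrix (Fin n) (Fin n) ℂ) {c : ℝ} (hc : c ≠ 0)
    (hGf : ∀ x i kc, G x i kc =
      ((c : ℝ) : ℂ) * ∑ p ∈ Pw.filter (fun p ↦ cls p = (x, kc)), ε p * ω p * Λ p i)
    (F : J → Fin n → ℂ) {z : Fin n → ℂ} (hfid : ∑ x, G x *ᵥ F x = z) (i : Fin n) :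
    ∑ p ∈ Pw, (ω p : ℂ) * Λ p i * (ε p * F (cls p).1 (cls p).2) = (c : ℂ)⁻¹ * z i := by
  have hc' : (c : ℂ) ≠ 0 := ofReal_ne_zero.2 hc
  have h := sum_phased_eq_of_class_sums Pw cls ε (fun p ↦ (ω p : ℂ) * Λ p i) (fun x kc ↦ F x kc)
    (fun x kc ↦ G x i kc) hc' (fun x kc ↦ by
      rw [hGf]
      congr 1
      exact Finset.sum_congr rfl fun p _ ↦ by ring)
  calc ∑ p ∈ Pw, (ω p : ℂ) * Λ p i * (ε p * F (cls p).1 (cls p).2)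
      = (c : ℂ)⁻¹ * ∑ x, ∑ kc, G x i kc * F x kc := h
    _ = (c : ℂ)⁻¹ * z i := by
        congr 1
        rw [← hfid, Finset.sum_apply]
        exact Finset.sum_congr rfl fun x _ ↦ rfl

/-- **The primes off the window contribute `O_Y(1)` plus a tail**: if `‖L(m)‖ ≤ B` at every prime
and `‖L(m)‖ ≤ 4 m^{-σ}` at the primes `m ≥ 5`, and the window `Pw` contains the primes in
`(Y, P]` (`Y ≥ 5`), then `‖∑_{p ∉ Pw} L(p)‖ ≤ (Y + 1) B + 4 ∑_{p > P} p^{-σ}`. [folklore] -/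
theorem norm_tsum_off_window_le {L : ℕ → ℂ} {Pw : Finset ℕ} {Y P : ℕ} {σ B : ℝ}
    (hmem : ∀ m, m.Prime → Y < m → m ≤ P → m ∈ Pw) (hY : 5 ≤ Y) (hB : 0 ≤ B)
    (hsmall : ∀ m, m.Prime → ‖L m‖ ≤ B)
    (hlarge : ∀ m, m.Prime → 5 ≤ m → ‖L m‖ ≤ 4 * (m : ℝ) ^ (-σ))
    (hsum : Summable fun m : ℕ ↦ if m.Prime ∧ P < m then (m : ℝ) ^ (-σ) else 0) :
    ‖∑' m : ℕ, (if m.Prime ∧ m ∉ Pw then L m else 0)‖ ≤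
      ((Y : ℝ) + 1) * B + 4 * ∑' m : ℕ, (if m.Prime ∧ P < m then (m : ℝ) ^ (-σ) else 0) := by
  classical
  -- termwise bound by `B · [m ≤ Y] + 4 m^{-σ} [m prime, m > P]`
  have hle : ∀ m, ‖(if m.Prime ∧ m ∉ Pw then L m else 0)‖ ≤
      (if m < Y + 1 then B else 0) + 4 * (if m.Prime ∧ P < m then (m : ℝ) ^ (-σ) else 0) := by
    intro m
    have h1 : 0 ≤ (if m < Y + 1 then B else 0) := by split_ifs <;> positivity
    have h2 : 0 ≤ 4 * (if m.Prime ∧ P < m then (m : ℝ) ^ (-σ) else 0) := by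
      split_ifs <;> positivity
    by_cases h : m.Prime ∧ m ∉ Pw
    · rw [if_pos h]
      obtain ⟨hp, hnot⟩ := h
      by_cases hmY : m < Y + 1
      · rw [if_pos hmY]
        linarith [hsmall m hp]
      · have hPm : P < m := by
          by_contra hcon
          exact hnot (hmem m hp (by omega) (not_lt.1 hcon))
        rw [if_neg hmY, if_pos ⟨hp, hPm⟩, zero_add]
        exact hlarge m hp (by omega)
    · rw [if_neg h, norm_zero]
      positivity
  have hsb1 : Summable fun m : ℕ ↦ (if m < Y + 1 then B else 0) := by
    refine summable_of_ne_finset_zero (s := Finset.range (Y + 1)) fun m hm ↦ ?_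
    rw [Finset.mem_range] at hm
    rw [if_neg hm]
  have hsb : Summable fun m : ℕ ↦
      (if m < Y + 1 then B else 0) + 4 * (if m.Prime ∧ P < m then (m : ℝ) ^ (-σ) else 0) :=
    hsb1.add (hsum.mul_left 4)
  have hsn : Summable fun m ↦ ‖(if m.Prime ∧ m ∉ Pw then L m else 0)‖ :=
    Summable.of_nonneg_of_le (fun m ↦ norm_nonneg _) hle hsb
  calc ‖∑' m : ℕ, (if m.Prime ∧ m ∉ Pw then L m else 0)‖
      ≤ ∑' m, ‖(if m.Prime ∧ m ∉ Pw then L m else 0)‖ := norm_tsum_le_tsum_norm hsn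
    _ ≤ ∑' m, ((if m < Y + 1 then B else 0) +
          4 * (if m.Prime ∧ P < m then (m : ℝ) ^ (-σ) else 0)) := hsn.tsum_le_tsum hle hsb
    _ = (∑' m : ℕ, if m < Y + 1 then B else 0) +
          4 * ∑' m : ℕ, (if m.Prime ∧ P < m then (m : ℝ) ^ (-σ) else 0) := by
        rw [hsb1.tsum_add (hsum.mul_left 4), tsum_mul_left]
    _ = ((Y : ℝ) + 1) * B + 4 * ∑' m : ℕ, (if m.Prime ∧ P < m then (m : ℝ) ^ (-σ) else 0) := by
        congr 1
        rw [tsum_eq_sum (s := Finset.range (Y + 1)) (fun m hm ↦ if_neg (by simpa using hm)),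
          Finset.sum_congr rfl (fun m hm ↦ if_pos (Finset.mem_range.1 hm))]
        simp only [Finset.sum_const, Finset.card_range, nsmul_eq_mul]
        push_cast
        ring

/-- **The second-order terms on the window are `O(∑_p p^{-2})`**: for `σ ≥ 1`,
`∑_{p ∈ Pw} 6 (p^{-σ})² ≤ 6 ∑_p p^{-2}`. [folklore] -/
theorem sum_window_sq_le {Pw : Finset ℕ} (hPw : ∀ p ∈ Pw, p.Prime) {σ : ℝ} (hσ : 1 ≤ σ)
    (hT : Summable fun m : ℕ ↦ if m.Prime ∧ 0 < m then (m : ℝ) ^ (-(2 : ℝ)) else 0) :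
    ∑ p ∈ Pw, 6 * ((p : ℝ) ^ (-σ)) ^ 2 ≤
      6 * ∑' m : ℕ, (if m.Prime ∧ 0 < m then (m : ℝ) ^ (-(2 : ℝ)) else 0) := by
  rw [← Finset.mul_sum]
  refine mul_le_mul_of_nonneg_left ?_ (by norm_num)
  calc ∑ p ∈ Pw, ((p : ℝ) ^ (-σ)) ^ 2
      ≤ ∑ p ∈ Pw, (if p.Prime ∧ 0 < p then (p : ℝ) ^ (-(2 : ℝ)) else 0) := by
        refine Finset.sum_le_sum fun p hp ↦ ?_
        have hpp := hPw p hp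
        rw [if_pos ⟨hpp, hpp.pos⟩, ← Real.rpow_natCast, ← Real.rpow_mul (Nat.cast_nonneg p)]
        exact Real.rpow_le_rpow_of_exponent_le (by exact_mod_cast hpp.one_lt.le)
          (by push_cast; linarith)
    _ ≤ _ := hT.sum_le_tsum Pw fun m _ ↦ by split_ifs <;> positivity

/-! ### G4. Proposition 8 at level one, for a fixed target -/

section Prop8

open CongruenceSubgroup Metric Set
open scoped MatrixGroups
open Literature.NumberTheory.EllipticCurves.ModularForms
open Literature.NumberTheory.LFunctions

variable {k : ℤ}

/-- The summand `[m prime ∧ y < m] m^{-σ}` is summable for `σ > 1`. [folklore] -/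
theorem summable_prime_gt_rpow (y : ℕ) {σ : ℝ} (hσ : 1 < σ) :
    Summable fun m : ℕ ↦ if m.Prime ∧ y < m then (m : ℝ) ^ (-σ) else 0 := by
  refine (Real.summable_nat_rpow.2 (by linarith : -σ < -1)).of_nonneg_of_le (fun m ↦ ?_) fun m ↦ ?_
  · split_ifs <;> positivity
  · split_ifs
    · exact le_rfl
    · positivity

-- one long assembly proof (the constants of Props. 9–10, the window, the error map, Brouwer):
-- the cumulative elaboration exceeds the default budget
set_option maxHeartbeats 800000 in
/-- **Booker–Thorne 2014, Proposition 8, at level one, for one target** (with §4, step (1)):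
for distinct newforms `g_i ∈ S_k(SL(2,ℤ))` (`i < n`, `n ≥ 1`) satisfying the Ramanujan bound at
every prime (Deligne) and Lemma 3 (quasi-orthogonality, two-sided form at modulus `1`), and any
`t ∈ ℂⁿ`, there is `η > 0` such that for every `σ ∈ (1, 1 + η]` some completely multiplicative
unimodular twist `e` (trivial at the primes `< 5`) has
`∑_m a_{g_i}(m) e(m) m^{-(σ + (k−1)/2)} = exp(t_i)` for all `i` — "Taking exponentials yields the
proposition": `∏_p L(σ + it_p, π_{i,p}) = z_i` with `z_i = exp t_i`. Proof as printed (Props. 9–10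
of the tree, the linearisation of the local logarithms, Brouwer's fixed point theorem on the
polydisc `(C + R')D`), the primes `p ≤ Y` and `p > P` carrying the trivial phase.
[cite: BookerThorne2014, Prop. 8 and its proof, §4 step (1)] -/
theorem exists_twist_eq_exp_target {n : ℕ} (hn : 0 < n) (g : Fin n → CuspForm (Gamma0 1) k)
    (hg : ∀ i, IsNewform0 (g i))
    (hR : ∀ (i : Fin n) (p : ℕ), p.Prime → ‖cuspCoeff (g i) p‖ ≤ 2 * (p : ℝ) ^ (((k : ℝ) - 1) / 2))
    (hL3 : ∃ C : ℝ, 0 ≤ C ∧ ∀ (y : ℕ), 2 ≤ y → ∀ σ : ℝ, 1 < σ → σ ≤ 2 →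
      C / Real.log y ≤ 1 / 4 → C * ((σ - 1) * Real.log y) ≤ 1 / 4 →
      ∀ u : Fin n → ℂ, ∑ i, ‖u i‖ ^ 2 = 1 →
        1 / 2 * (∑' m : ℕ, if m.Prime ∧ y < m then (m : ℝ) ^ (-σ) else 0) ≤
          ∑' m : ℕ, (if m.Prime ∧ y < m then
            ‖∑ i, u i * (cuspCoeff (g i) m * (m : ℂ) ^ (-(((k : ℂ) - 1) / 2)))‖ ^ 2 *
              (m : ℝ) ^ (-σ) else 0) ∧
        ∑' m : ℕ, (if m.Prime ∧ y < m then
            ‖∑ i, u i * (cuspCoeff (g i) m * (m : ℂ) ^ (-(((k : ℂ) - 1) / 2)))‖ ^ 2 *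
              (m : ℝ) ^ (-σ) else 0) ≤
          3 / 2 * (∑' m : ℕ, if m.Prime ∧ y < m then (m : ℝ) ^ (-σ) else 0))
    (t : Fin n → ℂ) :
    ∃ η : ℝ, 0 < η ∧ ∀ σ : ℝ, 1 < σ → σ ≤ 1 + η →
      ∃ e : ℕ →*₀ ℂ, (∀ p, p.Prime → ‖e p‖ = 1) ∧ (∀ p, p.Prime → p < 5 → e p = 1) ∧
        ∀ i, LSeries (fun m ↦ cuspCoeff (g i) m * e m) ((σ + ((k : ℝ) - 1) / 2 : ℝ) : ℂ) =
          cexp (t i) := by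
  classical
  -- ### constants depending only on `n` (and the compact set of Prop. 9)
  set κ : ℝ := ((k : ℝ) - 1) / 2 with hκ
  have hn1 : (1 : ℝ) ≤ n := by exact_mod_cast hn
  set r : ℝ := 2 * Real.sqrt n with hrdef
  have hr : 0 < r := by positivity
  set A : ℝ := n * (3 * r) with hAdef
  have hA : 0 ≤ A := by positivity
  set b : ℝ := (16 * r * (1 + 48 * r ^ 2) ^ (n - 1) * Real.sqrt n)⁻¹ with hbdef
  have hb : 0 < b := by positivity
  obtain ⟨K₁, m₁, hP9⟩ := prop9 (ι := Fin n) A hA hb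
  -- the index set of Prop. 9 is non-empty (else `∑_x g_x f_x(z) = z` fails at `z ≠ 0`)
  haveI : Nonempty (Fin n) := ⟨⟨0, hn⟩⟩
  have hJne : Nonempty ((Fin n × Fin 3) × (Fin K₁ × Fin m₁)) := by
    by_contra hJ
    rw [not_nonempty_iff] at hJ
    obtain ⟨f, -, -, hfid⟩ := hP9 (fun _ ↦ 0) (fun x ↦ (IsEmpty.false x).elim)
      (fun x ↦ (IsEmpty.false x).elim)
    have h0 := hfid (Pi.single (⟨0, hn⟩ : Fin n) (1 : ℂ)) (by
      rw [mem_closedBall_zero_iff, Pi.norm_single, norm_one])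
    rw [Finset.univ_eq_empty, Finset.sum_empty] at h0
    have := congrFun h0 ⟨0, hn⟩
    simp at this
  haveI := hJne
  set M : ℕ := Fintype.card ((Fin n × Fin 3) × (Fin K₁ × Fin m₁)) * n with hMdef
  have hM : 0 < M := Nat.mul_pos Fintype.card_pos hn
  have hMreal : (0 : ℝ) < M := by exact_mod_cast hM
  clear_value M
  -- `∑_p p^{-2}` and the atom bound
  set T₂ : ℝ := ∑' m : ℕ, if m.Prime ∧ 0 < m then (m : ℝ) ^ (-(2 : ℝ)) else 0 with hT₂
  have hT₂s : Summable fun m : ℕ ↦ if m.Prime ∧ 0 < m then (m : ℝ) ^ (-(2 : ℝ)) else 0 :=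
    summable_prime_gt_rpow 0 one_lt_two
  have hT₂0 : 0 ≤ T₂ := tsum_nonneg fun m ↦ by split_ifs <;> positivity
  clear_value T₂
  set W₀ : ℝ := Real.sqrt ((1 + r ^ 4) * T₂) with hW₀def
  have hW₀ : 0 ≤ W₀ := Real.sqrt_nonneg _
  clear_value W₀
  -- Lemma 3: the constant `C`, the starting point `Y` and the width `δ₁`
  obtain ⟨C, hC0, hL⟩ := hL3
  set Y : ℕ := max 5 ⌈Real.exp (4 * (C + 1))⌉₊ with hYdef
  have hY5 : 5 ≤ Y := le_max_left _ _
  have hY2 : 2 ≤ Y := le_trans (by norm_num) hY5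
  have hYexp : Real.exp (4 * (C + 1)) ≤ Y :=
    (Nat.le_ceil _).trans (by exact_mod_cast le_max_right 5 ⌈Real.exp (4 * (C + 1))⌉₊)
  clear_value Y
  have hlogY : 4 * (C + 1) ≤ Real.log Y := by
    rw [← Real.log_exp (4 * (C + 1))]
    exact Real.log_le_log (Real.exp_pos _) hYexp
  have hlogY0 : 0 < Real.log Y := lt_of_lt_of_le (by positivity) hlogY
  have hClog : C / Real.log Y ≤ 1 / 4 := by
    rw [div_le_div_iff₀ hlogY0 (by norm_num : (0 : ℝ) < 4)]
    nlinarith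
  set δ₁ : ℝ := 1 / (4 * (C + 1) * Real.log Y) with hδ₁
  have hδ₁0 : 0 < δ₁ := by positivity
  have hδ₁C : ∀ σ : ℝ, σ - 1 ≤ δ₁ → 0 ≤ σ - 1 → C * ((σ - 1) * Real.log Y) ≤ 1 / 4 := by
    intro σ h1 h0
    calc C * ((σ - 1) * Real.log Y) ≤ (C + 1) * (δ₁ * Real.log Y) := by
          apply mul_le_mul (by linarith) (mul_le_mul_of_nonneg_right h1 hlogY0.le)
            (by positivity) (by positivity)
      _ = 1 / 4 := by rw [hδ₁]; field_simp
  clear_value δ₁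
  -- error budget and target size
  set E₀ : ℝ := 6 * T₂ + ((Y : ℝ) + 1) * (Real.log 4 + Real.pi) + 1 with hE₀
  have hE₀0 : 0 ≤ E₀ := by positivity
  clear_value E₀
  set ρ : ℝ := E₀ + ‖t‖ with hρ
  have hρ0 : 0 ≤ ρ := by positivity
  clear_value ρ
  -- the prime number theorem: `s(Y, σ) ≥ 2(Mρ + 64 M n W₀) + 4` for `σ` near `1`
  obtain ⟨η₂, hη₂, hSbig⟩ :=
    exists_forall_le_tsum_prime_residue_rpow 1 Y (2 * (M * ρ + 64 * M * n * W₀) + 4)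
  refine ⟨min 1 (min δ₁ η₂), by positivity, fun σ hσ1 hση ↦ ?_⟩
  have hσ2 : σ ≤ 2 := by linarith [min_le_left 1 (min δ₁ η₂)]
  have hσδ : σ - 1 ≤ δ₁ := by linarith [min_le_right 1 (min δ₁ η₂), min_le_left δ₁ η₂]
  have hση₂ : σ ≤ 1 + η₂ := by linarith [min_le_right 1 (min δ₁ η₂), min_le_right δ₁ η₂]
  clear hση
  -- ### the prime sums at `σ`
  have hsumS : Summable fun m : ℕ ↦ if m.Prime ∧ Y < m then (m : ℝ) ^ (-σ) else 0 :=
    summable_prime_gt_rpow Y hσ1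
  obtain ⟨S, hSdef⟩ : ∃ S : ℝ, S = ∑' m : ℕ, if m.Prime ∧ Y < m then (m : ℝ) ^ (-σ) else 0 :=
    ⟨_, rfl⟩
  have hSK : 2 * (M * ρ + 64 * M * n * W₀) + 4 ≤ S := by
    have h := hSbig σ hσ1 hση₂ 0 (isUnit_of_subsingleton _)
    rw [hSdef]
    refine h.trans (le_of_eq (tsum_congr fun m ↦ ?_))
    have : ((m : ℕ) : ZMod 1) = 0 := Subsingleton.elim _ _
    simp [this]
  clear hSbig
  have hS4 : 4 ≤ S := by
    have : 0 ≤ 2 * (M * ρ + 64 * M * n * W₀) := by positivity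
    linarith
  have hS0 : 0 < S := by linarith
  have hn0 : (0 : ℝ) < n := by linarith
  -- ### the window `Y < p ≤ P` with a small tail
  obtain ⟨P, hYP, hTP⟩ := exists_tail_lt (f := fun m : ℕ ↦ (m : ℝ) ^ (-σ)) (fun m ↦ by positivity)
    hsumS (ε := min (S / (16 * n)) (1 / 4)) (by positivity)
  have hsumTP : Summable fun m : ℕ ↦ if m.Prime ∧ P < m then (m : ℝ) ^ (-σ) else 0 :=
    summable_prime_gt_rpow P hσ1
  have hTP0 : 0 ≤ ∑' m : ℕ, (if m.Prime ∧ P < m then (m : ℝ) ^ (-σ) else 0) :=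
    tsum_nonneg fun m ↦ by split_ifs <;> positivity
  have hSsplit0 := tsum_prime_gt_eq_sum_add_tsum_real hYP hsumS
  rw [← hSdef] at hSsplit0
  obtain ⟨TP, hTPdef⟩ : ∃ TP : ℝ, TP = ∑' m : ℕ, if m.Prime ∧ P < m then (m : ℝ) ^ (-σ) else 0 :=
    ⟨_, rfl⟩
  rw [← hTPdef] at hTP hTP0 hSsplit0
  have hTP1 : TP < S / (16 * n) := lt_of_lt_of_le hTP (min_le_left _ _)
  have hTP2 : TP < 1 / 4 := lt_of_lt_of_le hTP (min_le_right _ _)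
  clear hTP
  set Pw : Finset ℕ := (Finset.Ioc Y P).filter Nat.Prime with hPwdef
  have hPw : ∀ p ∈ Pw, p.Prime := fun p hp ↦ (Finset.mem_filter.1 hp).2
  have hPwY : ∀ p ∈ Pw, Y < p := fun p hp ↦ (Finset.mem_Ioc.1 (Finset.mem_filter.1 hp).1).1
  have hPw5 : ∀ p ∈ Pw, 5 ≤ p := fun p hp ↦ hY5.trans (hPwY p hp).le
  have hPwlt5 : ∀ p, p.Prime → p < 5 → p ∉ Pw := fun p _ hp5 hp ↦ by
    have := hPw5 p hp; omega
  obtain ⟨ω, hωdef⟩ : ∃ ω : ℕ → ℝ, ∀ m, ω m = (m : ℝ) ^ (-σ) := ⟨_, fun _ ↦ rfl⟩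
  have hω : ∀ m, 0 ≤ ω m := fun m ↦ by rw [hωdef]; positivity
  set s₀ : ℝ := ∑ p ∈ Pw, ω p with hs₀def
  have hSsplit : S = s₀ + TP := by
    rw [hs₀def, Finset.sum_congr rfl fun p _ ↦ hωdef p]
    exact hSsplit0
  clear hSsplit0
  have hs₀S : s₀ ≤ S := by linarith
  have hs₀half : S / 2 ≤ s₀ := by
    have : S / (16 * n) ≤ S / 2 := by
      rw [div_le_div_iff₀ (by positivity) two_pos]; nlinarith
    linarith
  have hs₀pos : 0 < s₀ := by linarith
  -- ### the vectors `Λ_p = (a_{g_i}(p) p^{-κ})_i`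
  obtain ⟨Λ, hΛp, hΛnp⟩ : ∃ Λ : ℕ → EuclideanSpace ℂ (Fin n),
      (∀ m, m.Prime → Λ m = WithLp.toLp 2 (fun i ↦ cuspCoeff (g i) m * (m : ℂ) ^ (-(κ : ℂ)))) ∧
      (∀ m, ¬ m.Prime → Λ m = 0) :=
    ⟨fun m ↦ if m.Prime then WithLp.toLp 2 (fun i ↦ cuspCoeff (g i) m * (m : ℂ) ^ (-(κ : ℂ)))
      else 0, fun m hm ↦ if_pos hm, fun m hm ↦ if_neg hm⟩
  have hentry : ∀ (i : Fin n) (p : ℕ), p.Prime → ‖cuspCoeff (g i) p * (p : ℂ) ^ (-(κ : ℂ))‖ ≤ 2 := by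
    intro i p hp
    have hp0 : (0 : ℝ) < p := by exact_mod_cast hp.pos
    rw [norm_mul, norm_natCast_cpow_of_pos hp.pos]
    simp only [neg_re, ofReal_re]
    calc ‖cuspCoeff (g i) p‖ * (p : ℝ) ^ (-κ) ≤ 2 * (p : ℝ) ^ κ * (p : ℝ) ^ (-κ) :=
          mul_le_mul_of_nonneg_right (hR i p hp) (by positivity)
      _ = 2 := by rw [mul_assoc, ← Real.rpow_add hp0, add_neg_cancel, Real.rpow_zero, mul_one]
  have hΛ : ∀ m, ‖Λ m‖ ≤ r := by
    intro m
    by_cases hm : m.Prime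
    · rw [hΛp m hm]
      calc _ ≤ 2 * Real.sqrt n := norm_toLp_le_of_forall_le zero_le_two (fun i ↦ hentry i m hm)
        _ = r := by rw [hrdef]
    · rw [hΛnp m hm, norm_zero]; exact hr.le
  have hΛsq : ∀ m, ‖Λ m‖ ^ 2 ≤ 4 * n := by
    intro m
    calc ‖Λ m‖ ^ 2 ≤ r ^ 2 := pow_le_pow_left₀ (norm_nonneg _) (hΛ m) 2
      _ = 4 * n := by rw [hrdef, mul_pow, Real.sq_sqrt hn0.le]; norm_num
  -- ### the atom bound `W₀`
  have hW : Real.sqrt (∑ p ∈ Pw, ω p ^ 2 * (1 + ‖Λ p‖ ^ 4)) ≤ W₀ := by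
    rw [hW₀def]
    refine Real.sqrt_le_sqrt ?_
    have hterm : ∀ p ∈ Pw, ω p ^ 2 * (1 + ‖Λ p‖ ^ 4) ≤
        (1 + r ^ 4) * (if p.Prime ∧ 0 < p then (p : ℝ) ^ (-(2 : ℝ)) else 0) := by
      intro p hp
      have hpp := hPw p hp
      have hp1 : (1 : ℝ) ≤ p := by exact_mod_cast hpp.one_lt.le
      rw [if_pos ⟨hpp, hpp.pos⟩]
      have hp0 : (0 : ℝ) < p := by positivity
      have h1 : ω p ^ 2 ≤ (p : ℝ) ^ (-(2 : ℝ)) := by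
        rw [hωdef, ← Real.rpow_natCast, ← Real.rpow_mul hp0.le]
        exact Real.rpow_le_rpow_of_exponent_le hp1 (by push_cast; linarith)
      have hΛ4 : 0 ≤ ‖Λ p‖ ^ 4 := by positivity
      have h2 : 1 + ‖Λ p‖ ^ 4 ≤ 1 + r ^ 4 := by
        have := pow_le_pow_left₀ (norm_nonneg _) (hΛ p) 4
        linarith
      have h3 : 0 ≤ (p : ℝ) ^ (-(2 : ℝ)) := by positivity
      calc ω p ^ 2 * (1 + ‖Λ p‖ ^ 4) ≤ (p : ℝ) ^ (-(2 : ℝ)) * (1 + r ^ 4) :=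
            mul_le_mul h1 h2 (by linarith) h3
        _ = (1 + r ^ 4) * (p : ℝ) ^ (-(2 : ℝ)) := by ring
    calc ∑ p ∈ Pw, ω p ^ 2 * (1 + ‖Λ p‖ ^ 4)
        ≤ ∑ p ∈ Pw, (1 + r ^ 4) * (if p.Prime ∧ 0 < p then (p : ℝ) ^ (-(2 : ℝ)) else 0) :=
          Finset.sum_le_sum hterm
      _ = (1 + r ^ 4) * ∑ p ∈ Pw, (if p.Prime ∧ 0 < p then (p : ℝ) ^ (-(2 : ℝ)) else 0) := by
          rw [Finset.mul_sum]
      _ ≤ (1 + r ^ 4) * T₂ := by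
          rw [hT₂]
          refine mul_le_mul_of_nonneg_left ?_ (by positivity)
          exact hT₂s.sum_le_tsum Pw fun m _ ↦ by split_ifs <;> positivity
  -- ### the Gram form on the window, from Lemma 3 and the tail
  have hgram : ∀ u : EuclideanSpace ℂ (Fin n), ‖u‖ = 1 →
      (∑ p ∈ Pw, ω p) / 4 ≤ ∑ p ∈ Pw, ω p * ‖⟪u, Λ p⟫_ℂ‖ ^ 2 := by
    intro u hu
    set u' : Fin n → ℂ := fun i ↦ conj (u i) with hu'
    have hu'1 : ∑ i, ‖u' i‖ ^ 2 = 1 := sum_norm_conj_sq_eq u hu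
    obtain ⟨hlow, -⟩ := hL Y hY2 σ hσ1 hσ2 hClog (hδ₁C σ hσδ (by linarith)) u' hu'1
    -- the summand of Lemma 3 in terms of `⟪u, Λ_m⟫`
    set q : ℕ → ℝ := fun m ↦ ‖∑ i, u' i * (cuspCoeff (g i) m * (m : ℂ) ^ (-(((k : ℂ) - 1) / 2)))‖ ^ 2 *
      (m : ℝ) ^ (-σ) with hqdef
    have hκC : (-(((k : ℂ) - 1) / 2)) = (-(κ : ℂ)) := by rw [hκ]; push_cast; ring
    have hq_eq : ∀ m, m.Prime → q m = ω m * ‖⟪u, Λ m⟫_ℂ‖ ^ 2 := by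
      intro m hm
      simp only [hqdef]
      rw [hΛp m hm, hωdef, inner_toLp_eq_sum, hκC, mul_comm]
    have hq_le : ∀ m, m.Prime → q m ≤ 4 * n * (m : ℝ) ^ (-σ) := by
      intro m hm
      rw [hq_eq m hm, hωdef, mul_comm]
      exact mul_le_mul_of_nonneg_right ((norm_inner_sq_le u (Λ m) hu).trans (hΛsq m)) (by positivity)
    have hq0 : ∀ m, 0 ≤ q m := fun m ↦ by simp only [hqdef]; positivity
    have hsumq : Summable fun m : ℕ ↦ if m.Prime ∧ Y < m then q m else 0 := by
      refine (hsumS.mul_left (4 * (n : ℝ))).of_nonneg_of_le (fun m ↦ by split_ifs <;> simp [hq0])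
        fun m ↦ ?_
      split_ifs with h
      · exact hq_le m h.1
      · simp
    have hsplitq := tsum_prime_gt_eq_sum_add_tsum_real (f := q) hYP hsumq
    -- the tail of the Lemma-3 sum is small
    have htailq : (∑' m : ℕ, if m.Prime ∧ P < m then q m else 0) ≤ 4 * n * TP := by
      rw [hTPdef, ← tsum_mul_left]
      refine Summable.tsum_le_tsum (fun m ↦ ?_) ?_ (hsumTP.mul_left _)
      · split_ifs with h
        · exact hq_le m h.1
        · simp
      · refine (hsumTP.mul_left (4 * (n : ℝ))).of_nonneg_of_le (fun m ↦ by split_ifs <;> simp [hq0])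
          fun m ↦ ?_
        split_ifs with h
        · exact hq_le m h.1
        · simp
    have hwin : ∑ p ∈ Pw, q p = ∑ p ∈ Pw, ω p * ‖⟪u, Λ p⟫_ℂ‖ ^ 2 :=
      Finset.sum_congr rfl fun p hp ↦ hq_eq p (hPw p hp)
    rw [← hwin]
    have h1 : 1 / 2 * S ≤ ∑ p ∈ Pw, q p + ∑' m : ℕ, (if m.Prime ∧ P < m then q m else 0) := by
      rw [hSdef, ← hsplitq]; exact hlow
    have h2 : 4 * n * TP ≤ S / 4 := by
      have := hTP1.le
      rw [le_div_iff₀ (by positivity)] at this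
      linarith
    have h3 : (∑ p ∈ Pw, ω p) / 4 ≤ S / 4 := by
      rw [div_le_div_iff₀ (by norm_num : (0 : ℝ) < 4) (by norm_num)]; linarith
    linarith
  -- ### Prop. 10 and Prop. 9
  have hbig : 64 * (Fintype.card ((Fin n × Fin 3) × (Fin K₁ × Fin m₁)) * n) * n * W₀ ≤
      ∑ p ∈ Pw, ω p := by
    have h1 : (64 : ℝ) * (Fintype.card ((Fin n × Fin 3) × (Fin K₁ × Fin m₁)) * n) * n * W₀ =
        64 * M * n * W₀ := by rw [hMdef]; push_cast; ring
    rw [h1]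
    have : 0 ≤ (M : ℝ) * ρ := by positivity
    change 64 * (M : ℝ) * n * W₀ ≤ s₀
    linarith
  obtain ⟨cls, ε, G, hε1, hGf, hGup, hGlow⟩ :=
    abstract_prop10 hn Pw ω hω hs₀pos Λ hr hΛ hW₀ hW hgram hbig
  obtain ⟨f, hfcont, hfunit, hfid⟩ := hP9 G hGup hGlow
  -- the scale `μ = s₀ / M ≥ ρ`
  set μ : ℝ := s₀ / M with hμdef
  have hμρ : ρ ≤ μ := by
    rw [hμdef, le_div_iff₀ hMreal]
    have : 0 ≤ (64 : ℝ) * M * n * W₀ := by positivity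
    calc ρ * M = M * ρ := mul_comm _ _
      _ ≤ s₀ := by linarith
  have hμ0 : 0 < μ := by positivity
  clear_value μ
  -- ### Stage 3: the abscissa `σ' = σ + κ`, the scaling, the phases
  set σ' : ℝ := σ + κ with hσ'def
  have hσ'1 : ((k : ℝ) - 1) / 2 + 1 < σ' := by rw [hσ'def, hκ]; linarith
  have hσ'1le : ((k : ℝ) - 1) / 2 + 1 ≤ σ' := hσ'1.le
  have hσ'κ : σ' - ((k : ℝ) - 1) / 2 = σ := by rw [hσ'def, hκ]; ring
  have hzw : ∀ w ∈ closedBall (0 : Fin n → ℂ) ρ,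
      (μ⁻¹ : ℝ) • w ∈ closedBall (0 : Fin n → ℂ) 1 := by
    intro w hw
    rw [mem_closedBall_zero_iff] at hw ⊢
    rw [norm_smul, Real.norm_eq_abs, abs_inv, abs_of_pos hμ0, inv_mul_le_iff₀ hμ0, mul_one]
    exact hw.trans hμρ
  obtain ⟨φ, hφdef⟩ : ∃ φ : (Fin n → ℂ) → ℕ → ℂ, ∀ w m, φ w m =
      if m ∈ Pw then ε m * f (cls m).1 ((μ⁻¹ : ℝ) • w) (cls m).2 else 1 := ⟨_, fun _ _ ↦ rfl⟩
  have hφ1 : ∀ w m, m ∉ Pw → φ w m = 1 := fun w m hm ↦ by rw [hφdef, if_neg hm]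
  have hφin : ∀ w, ∀ m ∈ Pw, φ w m = ε m * f (cls m).1 ((μ⁻¹ : ℝ) • w) (cls m).2 :=
    fun w m hm ↦ by rw [hφdef, if_pos hm]
  have hφnorm : ∀ w ∈ closedBall (0 : Fin n → ℂ) ρ, ∀ m, ‖φ w m‖ = 1 := by
    intro w hw m
    by_cases hm : m ∈ Pw
    · rw [hφin w m hm, norm_mul, hε1, one_mul]
      exact hfunit _ _ (hzw w hw) _
    · rw [hφ1 w m hm, norm_one]
  -- ### the local logarithms `ℓ_i(m, u) = -log(1 − a_i(m) u m^{-σ'} + m^{k-1} u² m^{-2σ'})`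
  obtain ⟨ℓ, hℓdef⟩ : ∃ ℓ : Fin n → ℕ → ℂ → ℂ, ∀ i m u, ℓ i m u =
      -log (1 - (cuspCoeff (g i) m * u * (m : ℂ) ^ (-(σ' : ℂ)) -
        (m : ℂ) ^ (k - 1) * u ^ 2 * ((m : ℂ) ^ (-(σ' : ℂ))) ^ 2)) := ⟨_, fun _ _ _ ↦ rfl⟩
  have hsumℓ : ∀ w ∈ closedBall (0 : Fin n → ℂ) ρ, ∀ i,
      Summable fun q : Nat.Primes ↦ ℓ i q (φ w q) := by
    intro w hw i
    have h := summable_neg_log_local (g := g i) (e := φ w) (fun p _ ↦ hφnorm w hw p) (hR i) hσ'1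
    refine h.congr fun q ↦ ?_
    rw [hℓdef]
  have hdecomp : ∀ w ∈ closedBall (0 : Fin n → ℂ) ρ, ∀ i,
      ∑' q : Nat.Primes, ℓ i q (φ w q) =
        ∑ p ∈ Pw, ℓ i p (φ w p) + ∑' m : ℕ, (if m.Prime ∧ m ∉ Pw then ℓ i m 1 else 0) :=
    fun w hw i ↦ tsum_primes_local_eq_sum_add hPw (ℓ i) (hφ1 w) (hsumℓ w hw i)
  -- ### the main term: `∑_{p ∈ Pw} a_i(p) φ_p(w) p^{-σ'} = w_i`
  have hcpow : ∀ p : ℕ, p.Prime →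
      (p : ℂ) ^ (-(σ' : ℂ)) = (p : ℂ) ^ (-(κ : ℂ)) * ((ω p : ℝ) : ℂ) := by
    intro p hp
    have hp0 : (p : ℂ) ≠ 0 := Nat.cast_ne_zero.2 hp.ne_zero
    rw [hωdef, Complex.ofReal_cpow (Nat.cast_nonneg p), Complex.ofReal_natCast,
      ← Complex.cpow_add _ _ hp0]
    congr 1
    rw [hσ'def]
    push_cast
    ring
  have hcardM : (Fintype.card ((Fin n × Fin 3) × (Fin K₁ × Fin m₁)) * n : ℝ) = M := by
    rw [hMdef]; push_cast; ring
  have hc0 : (Fintype.card ((Fin n × Fin 3) × (Fin K₁ × Fin m₁)) * n : ℝ) / ∑ p ∈ Pw, ω p ≠ 0 := by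
    rw [hcardM]; exact (div_pos hMreal hs₀pos).ne'
  have hcμ : ((Fintype.card ((Fin n × Fin 3) × (Fin K₁ × Fin m₁)) * n : ℝ) / ∑ p ∈ Pw, ω p)⁻¹ =
      μ := by
    rw [inv_div, hμdef, hcardM]
  have hmain : ∀ w ∈ closedBall (0 : Fin n → ℂ) ρ, ∀ i,
      ∑ p ∈ Pw, cuspCoeff (g i) p * φ w p * (p : ℂ) ^ (-(σ' : ℂ)) = w i := by
    intro w hw i
    have hL1 := sum_window_linear_eq Pw cls ε ω Λ G hc0 hGf (fun x ↦ f x ((μ⁻¹ : ℝ) • w))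
      (hfid _ (hzw w hw)) i
    have hterm : ∀ p ∈ Pw, cuspCoeff (g i) p * φ w p * (p : ℂ) ^ (-(σ' : ℂ)) =
        (ω p : ℂ) * Λ p i * (ε p * f (cls p).1 ((μ⁻¹ : ℝ) • w) (cls p).2) := by
      intro p hp
      rw [hφin w p hp, hcpow p (hPw p hp), hΛp p (hPw p hp), PiLp.toLp_apply]
      ring
    rw [Finset.sum_congr rfl hterm, hL1, Pi.smul_apply, Complex.real_smul, ← Complex.ofReal_inv,
      hcμ, ← mul_assoc, ← Complex.ofReal_mul, mul_inv_cancel₀ hμ0.ne', Complex.ofReal_one,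
      one_mul]
  -- ### the error terms
  have hlin : ∀ w ∈ closedBall (0 : Fin n → ℂ) ρ, ∀ i, ∀ p ∈ Pw,
      ‖ℓ i p (φ w p) - cuspCoeff (g i) p * φ w p * (p : ℂ) ^ (-(σ' : ℂ))‖ ≤
        6 * ((p : ℝ) ^ (-σ)) ^ 2 := by
    intro w hw i p hp
    have h := norm_neg_log_sub_linear_le (g := g i) (hPw p hp) (hPw5 p hp) (hR i p (hPw p hp))
      (hφnorm w hw p) hσ'1le
    rw [hσ'κ] at h
    rw [hℓdef]
    exact h
  have hwin : ∀ w ∈ closedBall (0 : Fin n → ℂ) ρ, ∀ i,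
      ‖∑ p ∈ Pw, (ℓ i p (φ w p) - cuspCoeff (g i) p * φ w p * (p : ℂ) ^ (-(σ' : ℂ)))‖ ≤
        6 * T₂ := by
    intro w hw i
    calc _ ≤ ∑ p ∈ Pw, ‖ℓ i p (φ w p) - cuspCoeff (g i) p * φ w p * (p : ℂ) ^ (-(σ' : ℂ))‖ :=
          norm_sum_le _ _
      _ ≤ ∑ p ∈ Pw, 6 * ((p : ℝ) ^ (-σ)) ^ 2 := Finset.sum_le_sum (hlin w hw i)
      _ ≤ 6 * T₂ := by rw [hT₂]; exact sum_window_sq_le hPw hσ1.le hT₂s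
  have hoff : ∀ i, ‖∑' m : ℕ, (if m.Prime ∧ m ∉ Pw then ℓ i m 1 else 0)‖ ≤
      ((Y : ℝ) + 1) * (Real.log 4 + Real.pi) + 4 * TP := by
    intro i
    rw [hTPdef]
    refine norm_tsum_off_window_le (L := fun m ↦ ℓ i m 1) (fun m hm hYm hmP ↦ ?_) hY5
      (by positivity) (fun m hm ↦ ?_) (fun m hm hm5 ↦ ?_) hsumTP
    · exact Finset.mem_filter.2 ⟨Finset.mem_Ioc.2 ⟨hYm, hmP⟩, hm⟩
    · have h := norm_log_local_one_le (g := g i) hm (hR i m hm) hσ'1le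
      rw [hℓdef]
      exact h
    · have h := norm_neg_log_local_le (g := g i) hm hm5 (hR i m hm) (ε := 1) (by simp) hσ'1le
      rw [hσ'κ] at h
      rw [hℓdef]
      exact h
  have hErr : ∀ w ∈ closedBall (0 : Fin n → ℂ) ρ, ∀ i,
      ‖∑' q : Nat.Primes, ℓ i q (φ w q) - w i‖ ≤ E₀ := by
    intro w hw i
    rw [hdecomp w hw i]
    have hsplit : ∑ p ∈ Pw, ℓ i p (φ w p) +
        (∑' m : ℕ, if m.Prime ∧ m ∉ Pw then ℓ i m 1 else 0) - w i =
        ∑ p ∈ Pw, (ℓ i p (φ w p) - cuspCoeff (g i) p * φ w p * (p : ℂ) ^ (-(σ' : ℂ))) +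
          ∑' m : ℕ, (if m.Prime ∧ m ∉ Pw then ℓ i m 1 else 0) := by
      rw [Finset.sum_sub_distrib, hmain w hw i]; ring
    rw [hsplit]
    calc _ ≤ ‖∑ p ∈ Pw, (ℓ i p (φ w p) - cuspCoeff (g i) p * φ w p * (p : ℂ) ^ (-(σ' : ℂ)))‖ +
          ‖∑' m : ℕ, (if m.Prime ∧ m ∉ Pw then ℓ i m 1 else 0)‖ := norm_add_le _ _
      _ ≤ 6 * T₂ + (((Y : ℝ) + 1) * (Real.log 4 + Real.pi) + 4 * TP) :=
          add_le_add (hwin w hw i) (hoff i)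
      _ ≤ E₀ := by rw [hE₀]; linarith
  -- ### continuity of the error map on the polydisc `‖w‖ ≤ ρ`
  have hcontφ : ∀ p ∈ Pw, ContinuousOn (fun w : Fin n → ℂ ↦ φ w p) (closedBall 0 ρ) := by
    intro p hp
    have h1 : ContinuousOn (fun w : Fin n → ℂ ↦ f (cls p).1 ((μ⁻¹ : ℝ) • w)) (closedBall 0 ρ) :=
      (hfcont (cls p).1).comp (continuous_const_smul (μ⁻¹ : ℝ)).continuousOn
        (fun w hw ↦ hzw w hw)
    have h2 : ContinuousOn (fun w : Fin n → ℂ ↦ f (cls p).1 ((μ⁻¹ : ℝ) • w) (cls p).2)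
        (closedBall 0 ρ) :=
      (continuous_apply (cls p).2).comp_continuousOn h1
    exact (continuousOn_const.mul h2).congr fun w _ ↦ hφin w p hp
  have hcontℓ : ∀ i, ∀ p ∈ Pw,
      ContinuousOn (fun w : Fin n → ℂ ↦ ℓ i p (φ w p)) (closedBall 0 ρ) := by
    intro i p hp
    have hpp := hPw p hp
    have hφc := hcontφ p hp
    have hin : ContinuousOn (fun w : Fin n → ℂ ↦
        1 - (cuspCoeff (g i) p * φ w p * (p : ℂ) ^ (-(σ' : ℂ)) -
          (p : ℂ) ^ (k - 1) * (φ w p) ^ 2 * ((p : ℂ) ^ (-(σ' : ℂ))) ^ 2)) (closedBall 0 ρ) :=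
      continuousOn_const.sub (((continuousOn_const.mul hφc).mul continuousOn_const).sub
        ((continuousOn_const.mul (hφc.pow 2)).mul continuousOn_const))
    have hslit : ∀ w ∈ closedBall (0 : Fin n → ℂ) ρ,
        1 - (cuspCoeff (g i) p * φ w p * (p : ℂ) ^ (-(σ' : ℂ)) -
          (p : ℂ) ^ (k - 1) * (φ w p) ^ 2 * ((p : ℂ) ^ (-(σ' : ℂ))) ^ 2) ∈ slitPlane := by
      intro w hw
      have h := norm_local_le_half (g := g i) hpp (hPw5 p hp) (hR i p hpp) (hφnorm w hw p) hσ'1le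
      rw [Complex.mem_slitPlane_iff]
      left
      rw [Complex.sub_re, Complex.one_re]
      have := Complex.re_le_norm (cuspCoeff (g i) p * φ w p * (p : ℂ) ^ (-(σ' : ℂ)) -
          (p : ℂ) ^ (k - 1) * (φ w p) ^ 2 * ((p : ℂ) ^ (-(σ' : ℂ))) ^ 2)
      linarith
    exact ((hin.clog hslit).neg).congr fun w _ ↦ by simp only [hℓdef, Pi.neg_apply]
  have hcontF : ∀ i, ContinuousOn (fun w : Fin n → ℂ ↦ ∑' q : Nat.Primes, ℓ i q (φ w q))
      (closedBall 0 ρ) := by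
    intro i
    refine ((continuousOn_finsetSum Pw (fun p hp ↦ hcontℓ i p hp)).add
      (continuousOn_const
        (c := ∑' m : ℕ, (if m.Prime ∧ m ∉ Pw then ℓ i m 1 else 0)))).congr fun w hw ↦ ?_
    exact hdecomp w hw i
  -- ### Brouwer on the polydisc `‖w‖ ≤ ρ` for `Φ(w) = t − Err(w)`
  obtain ⟨Φ, hΦdef⟩ : ∃ Φ : (Fin n → ℂ) → (Fin n → ℂ), ∀ w i,
      Φ w i = t i - (∑' q : Nat.Primes, ℓ i q (φ w q) - w i) :=
    ⟨fun w i ↦ t i - (∑' q : Nat.Primes, ℓ i q (φ w q) - w i), fun _ _ ↦ rfl⟩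
  have hΦcont : ContinuousOn Φ (closedBall 0 ρ) := by
    refine continuousOn_pi.2 fun i ↦ ?_
    exact (continuousOn_const.sub ((hcontF i).sub (continuous_apply i).continuousOn)).congr
      fun w _ ↦ hΦdef w i
  have hΦmaps : MapsTo Φ (closedBall (0 : Fin n → ℂ) ρ) (closedBall 0 ρ) := by
    intro w hw
    rw [mem_closedBall_zero_iff]
    refine (pi_norm_le_iff_of_nonneg hρ0).2 fun i ↦ ?_
    rw [hΦdef, hρ]
    calc ‖t i - (∑' q : Nat.Primes, ℓ i q (φ w q) - w i)‖
        ≤ ‖t i‖ + ‖∑' q : Nat.Primes, ℓ i q (φ w q) - w i‖ := norm_sub_le _ _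
      _ ≤ ‖t‖ + E₀ := add_le_add (norm_le_pi_norm t i) (hErr w hw i)
      _ = E₀ + ‖t‖ := add_comm _ _
  obtain ⟨w₀, hw₀, hfix⟩ :=
    Literature.Topology.Euclidean.Brouwer.exists_fixedPoint_closedBall_of_finiteDimensional
      hρ0 hΦcont hΦmaps
  have hFt : ∀ i, ∑' q : Nat.Primes, ℓ i q (φ w₀ q) = t i := by
    intro i
    have h := congrFun hfix i
    rw [hΦdef] at h
    calc ∑' q : Nat.Primes, ℓ i q (φ w₀ q)
        = t i - (t i - (∑' q : Nat.Primes, ℓ i q (φ w₀ q) - w₀ i) - w₀ i) := by ring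
      _ = t i := by rw [h, sub_self, sub_zero]
  -- ### the twist with the phases of the fixed point
  obtain ⟨e, he⟩ := SWTwist.exists_twist (fun p ↦ arg (φ w₀ p))
  have heφ : ∀ p, p.Prime → e p = φ w₀ p := by
    intro p hp
    rw [he p hp]
    have h1 := norm_mul_exp_arg_mul_I (φ w₀ p)
    rwa [hφnorm w₀ hw₀ p, Complex.ofReal_one, one_mul] at h1
  have he1 : ∀ p, p.Prime → ‖e p‖ = 1 := fun p hp ↦ by rw [heφ p hp]; exact hφnorm w₀ hw₀ p
  have he5 : ∀ p, p.Prime → p < 5 → e p = 1 := fun p hp hp5 ↦ by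
    rw [heφ p hp, hφ1 w₀ p (hPwlt5 p hp hp5)]
  refine ⟨e, he1, he5, fun i ↦ ?_⟩
  have hL := LSeries_twisted_eq_exp_tsum (hg i) he1 he5 (hR i) hσ'1
  change LSeries (fun m ↦ cuspCoeff (g i) m * e m) ((σ' : ℝ) : ℂ) = cexp (t i)
  rw [hL, ← hFt i]
  congr 1
  exact tsum_congr fun q ↦ by rw [hℓdef, heφ q q.prop]

/-! ### G5. From Proposition 8 to the twisted zeros of a linear combination (§4, step (1)) -/

/-- **Booker–Thorne §4, step (1), for `P = ∑_g c_g x_g` at level one.** If Proposition 8 holds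
for every finite family of distinct level-one newforms and every target (hypothesis `h8`, the
conclusion of `exists_twist_eq_exp_target`), then for a finite set `S` of level-one newforms and
coefficients `c` with two distinct non-zero entries there is `η > 0` such that for every
`σ ∈ ((k+1)/2, (k+1)/2 + η]` some completely multiplicative unimodular twist `ε` has
`∑_n (∑_{g ∈ S} c_g a_g(n)) ε(n) n^{-σ} = 0`: choose a zero `z` of `P` with all `z_g ≠ 0`
(possible as two coefficients are non-zero), targets `t_g = log z_g`, and use the linearity of
the twisted Dirichlet series. [cite: BookerThorne2014, §4, step (1), with Lemma 7 for linear `P`] -/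
theorem levelOne_twistedZeros_of_prop8
    (h8 : ∀ (n : ℕ), 0 < n → ∀ g : Fin n → CuspForm (Gamma0 1) k, Function.Injective g →
      (∀ i, IsNewform0 (g i)) → ∀ t : Fin n → ℂ,
      ∃ η : ℝ, 0 < η ∧ ∀ σ : ℝ, 1 < σ → σ ≤ 1 + η →
        ∃ e : ℕ →*₀ ℂ, (∀ p, p.Prime → ‖e p‖ = 1) ∧
          ∀ i, LSeries (fun m ↦ cuspCoeff (g i) m * e m) ((σ + ((k : ℝ) - 1) / 2 : ℝ) : ℂ) =
            cexp (t i))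
    (S : Finset (CuspForm (Gamma0 1) k)) (hS : (↑S : Set _) ⊆ newforms0 1 k)
    (c : CuspForm (Gamma0 1) k → ℂ) (hpair : ∃ g ∈ S, ∃ g' ∈ S, g ≠ g' ∧ c g ≠ 0 ∧ c g' ≠ 0) :
    ∃ η : ℝ, 0 < η ∧ ∀ σ : ℝ, ((k : ℝ) + 1) / 2 < σ → σ ≤ ((k : ℝ) + 1) / 2 + η →
      ∃ ε : ℕ →*₀ ℂ, (∀ p, p.Prime → ‖ε p‖ = 1) ∧
        LSeries (fun n ↦ (∑ g ∈ S, c g * cuspCoeff g n) * ε n) σ = 0 := by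
  classical
  obtain ⟨g₀, hg₀, g₁, hg₁, hne, hc₀, hc₁⟩ := hpair
  -- the support of `c` inside `S`, enumerated
  set S' : Finset (CuspForm (Gamma0 1) k) := S.filter (fun g ↦ c g ≠ 0) with hS'
  have hg₀' : g₀ ∈ S' := Finset.mem_filter.2 ⟨hg₀, hc₀⟩
  have hg₁' : g₁ ∈ S' := Finset.mem_filter.2 ⟨hg₁, hc₁⟩
  set n : ℕ := S'.card with hn
  have hn0 : 0 < n := Finset.card_pos.2 ⟨g₀, hg₀'⟩
  set eqv := S'.equivFin with heqv
  set g : Fin n → CuspForm (Gamma0 1) k := fun i ↦ (eqv.symm i).1 with hgdef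
  have hgmem : ∀ i, g i ∈ S' := fun i ↦ (eqv.symm i).2
  have hginj : Function.Injective g := fun i j hij ↦ eqv.symm.injective (Subtype.ext hij)
  have hgnew : ∀ i, IsNewform0 (g i) := fun i ↦ hS (Finset.mem_filter.1 (hgmem i)).1
  -- two distinct indices
  set i₀ : Fin n := eqv ⟨g₀, hg₀'⟩ with hi₀
  set i₁ : Fin n := eqv ⟨g₁, hg₁'⟩ with hi₁
  have hi : i₀ ≠ i₁ := fun h ↦ hne (congrArg Subtype.val (eqv.injective h))
  have hgi₀ : g i₀ = g₀ := by simp [hgdef, hi₀]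
  have hgi₁ : g i₁ = g₁ := by simp [hgdef, hi₁]
  -- the zero `z` of `P = ∑ c_g x_g` with non-zero coordinates
  set C₀ : ℂ := ∑ i ∈ (Finset.univ.erase i₀).erase i₁, c (g i) with hC₀
  have hq : 0 < (‖C₀‖ + 1) / ‖c g₁‖ := div_pos (by positivity) (norm_pos_iff.2 hc₁)
  set z₁ : ℂ := (((‖C₀‖ + 1) / ‖c g₁‖ : ℝ) : ℂ) with hz₁
  have hz₁0 : z₁ ≠ 0 := by rw [hz₁]; exact_mod_cast hq.ne'
  have hkey : c g₁ * z₁ + C₀ ≠ 0 := by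
    intro h0
    have h1 : ‖c g₁ * z₁‖ = ‖C₀‖ + 1 := by
      rw [norm_mul, hz₁, Complex.norm_real, Real.norm_eq_abs, abs_of_pos hq,
        mul_div_cancel₀ _ (norm_ne_zero_iff.2 hc₁)]
    have h2 : c g₁ * z₁ = -C₀ := eq_neg_of_add_eq_zero_left h0
    rw [h2, norm_neg] at h1
    linarith
  set z : Fin n → ℂ := fun i ↦
    if i = i₀ then -(c g₁ * z₁ + C₀) / c g₀ else if i = i₁ then z₁ else 1 with hzdef
  have hzi₀ : z i₀ = -(c g₁ * z₁ + C₀) / c g₀ := by simp [hzdef]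
  have hzi₁ : z i₁ = z₁ := by simp [hzdef, hi.symm]
  have hz0 : ∀ i, z i ≠ 0 := by
    intro i
    simp only [hzdef]
    split_ifs
    · exact div_ne_zero (neg_ne_zero.2 hkey) hc₀
    · exact hz₁0
    · exact one_ne_zero
  have hsumz : ∑ i, c (g i) * z i = 0 := by
    rw [← Finset.add_sum_erase _ _ (Finset.mem_univ i₀),
      ← Finset.add_sum_erase _ _ (Finset.mem_erase.2 ⟨hi.symm, Finset.mem_univ i₁⟩)]
    have h3 : ∑ i ∈ (Finset.univ.erase i₀).erase i₁, c (g i) * z i = C₀ := by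
      rw [hC₀]
      refine Finset.sum_congr rfl fun j hj ↦ ?_
      simp only [Finset.mem_erase] at hj
      simp only [hzdef, if_neg hj.2.1, if_neg hj.1, mul_one]
    rw [h3, hzi₀, hzi₁, hgi₀, hgi₁]
    field_simp
    ring
  -- Proposition 8 for the targets `t_i = log z_i`
  obtain ⟨η, hη, H⟩ := h8 n hn0 g hginj hgnew (fun i ↦ Complex.log (z i))
  refine ⟨η, hη, fun σ hσ1 hσ2 ↦ ?_⟩
  obtain ⟨e, he, hL⟩ := H (σ - ((k : ℝ) - 1) / 2) (by linarith) (by linarith)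
  refine ⟨e, he, ?_⟩
  have hcast : ((σ - ((k : ℝ) - 1) / 2 + ((k : ℝ) - 1) / 2 : ℝ) : ℂ) = (σ : ℂ) := by
    congr 1; ring
  have hLi : ∀ i, LSeries (fun m ↦ cuspCoeff (g i) m * e m) σ = z i := by
    intro i
    have h := hL i
    rw [hcast, Complex.exp_log (hz0 i)] at h
    exact h
  -- linearity of the twisted series
  have hσre : ((k : ℝ) + 1) / 2 < (σ : ℂ).re := by simpa using hσ1
  have hsumm : ∀ f : CuspForm (Gamma0 1) k, LSeriesSummable (fun m ↦ cuspCoeff f m * e m) σ :=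
    fun f ↦ TwistedZero.LSeriesSummable_mul_twist he
      (LSeriesSummable_cuspCoeff_of_lt_re (strictWidthInfty_Gamma0 1) f hσre)
  have hterm : ∀ m : ℕ, LSeries.term (fun m ↦ (∑ f ∈ S, c f * cuspCoeff f m) * e m) σ m =
      ∑ f ∈ S, c f * LSeries.term (fun m ↦ cuspCoeff f m * e m) σ m := by
    intro m
    rcases eq_or_ne m 0 with rfl | hm
    · simp [LSeries.term_zero]
    · simp only [LSeries.term_of_ne_zero hm, Finset.sum_mul, Finset.sum_div]
      exact Finset.sum_congr rfl fun f _ ↦ by ring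
  have hlin : LSeries (fun m ↦ (∑ f ∈ S, c f * cuspCoeff f m) * e m) σ =
      ∑ f ∈ S, c f * LSeries (fun m ↦ cuspCoeff f m * e m) σ := by
    simp only [LSeries]
    rw [tsum_congr hterm, Summable.tsum_finsetSum (fun f _ ↦ (hsumm f).mul_left (c f))]
    exact Finset.sum_congr rfl fun f _ ↦ tsum_mul_left
  -- only the support contributes, and there the values are the `z_i`
  have hsupp : ∑ f ∈ S, c f * LSeries (fun m ↦ cuspCoeff f m * e m) σ =
      ∑ f ∈ S', c f * LSeries (fun m ↦ cuspCoeff f m * e m) σ := by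
    refine (Finset.sum_subset (Finset.filter_subset _ S) fun f hf hfS' ↦ ?_).symm
    have hcf : c f = 0 := by
      by_contra h
      exact hfS' (Finset.mem_filter.2 ⟨hf, h⟩)
    rw [hcf, zero_mul]
  have henum : ∑ f ∈ S', c f * LSeries (fun m ↦ cuspCoeff f m * e m) σ =
      ∑ i, c (g i) * LSeries (fun m ↦ cuspCoeff (g i) m * e m) σ := by
    rw [← Finset.sum_coe_sort S']
    exact (Equiv.sum_comp eqv.symm
      (fun x : {x // x ∈ S'} ↦ c x.1 * LSeries (fun m ↦ cuspCoeff x.1 m * e m) σ)).symm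
  rw [hlin, hsupp, henum]
  calc ∑ i, c (g i) * LSeries (fun m ↦ cuspCoeff (g i) m * e m) σ = ∑ i, c (g i) * z i :=
        Finset.sum_congr rfl fun i _ ↦ by rw [hLi i]
    _ = 0 := hsumz

open UpperHalfPlane in
/-- Non-zero level-one cusp forms have weight `≥ 12 ≥ 2` (`S_k(SL(2, ℤ)) = 0` for `k < 12`,
transported along `Γ₀(1) = SL(2, ℤ)`). [folklore] -/
theorem two_le_weight_of_isNewform0 {g : CuspForm (Gamma0 1) k} (hg : IsNewform0 g) : 2 ≤ k := by
  have hg0 : g ≠ 0 := IsNormalized.ne_zero_gamma0 hg.2.2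
  have h : (CuspForm.mcast rfl g coe_gamma0_one.symm : CuspForm 𝒮ℒ k) ≠ 0 := by
    intro h0
    apply hg0
    apply DFunLike.ext'
    have h1 : (⇑(CuspForm.mcast rfl g coe_gamma0_one.symm : CuspForm 𝒮ℒ k) : ℍ → ℂ) = ⇑g := rfl
    rw [← h1, h0, CuspForm.coe_zero, CuspForm.coe_zero]
  linarith [twelve_le_weight_of_ne_zero h]

end Prop8

end BookerThorne2014

/-! ### G6. The conditional theorem -/

section Final

open CongruenceSubgroup UpperHalfPlane
open scoped MatrixGroups
open Literature.NumberTheory.EllipticCurves.ModularForms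
open Literature.NumberTheory.LFunctions
open BookerThorne2014

/-- **Booker–Thorne 2014, Theorem 1 with Remark 2 at level one (`BookerThorne2014_levelOne_zeros`),
granted its two printed inputs**: Deligne's bound `|a_g(p)| ≤ 2 p^{(k−1)/2}` for the level-one
newforms (the tree's named fact `Deligne1974_heckeT_eigenvalue_norm_le`; Booker–Thorne assume the
generalized Ramanujan conjecture, Thm. 2, known here by [Deligne1974]) and Booker–Thorne's
**Lemma 3** for the representations `π_g` of distinct level-one newforms (conductor `1`, so the
hypothesis `(q, a ∏ cond π_j) = 1` reads `(q, a) = 1`; normalised eigenvalues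
`λ_g(p) = a_g(p) p^{-(k−1)/2}`): "Let `a` and `q` be positive integers … Then
`∑_{p > y, p ≡ a (mod q)} |u_1 λ_1(p) + … + u_n λ_n(p)|² / p^σ
  = (1/φ(q) + O((σ−1) log y + 1/log y)) ∑_{p > y} p^{-σ}` for all `y ≥ 2`, `σ ∈ (1, 2]` and all
unit vectors `u`, the implied constant depending only on `π_1, …, π_n` and `q`" — written with one
constant `C = C(g, q)`, integer `y ≥ 2`, and `|Σ − S/φ(q)| ≤ C ε S` (hypothesis `hL3`; its printed
proof rests on Liu–Ye's Selberg orthogonality for Rankin–Selberg `L`-functions, not in the tree).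
Everything else of the printed proof of Theorems 1–2 at level one is proved in the tree:
Propositions 9 and 10 (`prop9`, `abstract_prop10`), the twisted Euler products and local
logarithms (`DavenportHeilbronnDegreeTwoBTEuler`), Proposition 8 (`exists_twist_eq_exp_target`,
using Lemma 3 only at `q = 1`), §4 step (1) (`levelOne_twistedZeros_of_prop8`) and step (2) with the
reduction to `Λ_f` (`BookerThorne2014_levelOne_zeros_of_twistedZeros`).
[cite: BookerThorne2014, Thm. 1, §1 Rem. 2, Lemma 3, Props. 8–10, §4]
[cite: Deligne1974, Thm. 8.2] -/
theorem BookerThorne2014_levelOne_zeros_of_deligne_of_lemma3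
    (hD : Deligne1974_heckeT_eigenvalue_norm_le)
    (hL3 : ∀ (k : ℤ) (ι : Type) [Fintype ι] (g : ι → CuspForm (Gamma0 1) k),
      (∀ i, IsNewform0 (g i)) → Function.Injective g →
      ∀ (q : ℕ) [NeZero q], ∃ C : ℝ, ∀ (a : ZMod q), IsUnit a →
        ∀ (y : ℕ), 2 ≤ y → ∀ (σ : ℝ), 1 < σ → σ ≤ 2 →
          ∀ (u : ι → ℂ), ∑ i, ‖u i‖ ^ 2 = 1 →
            |(∑' n : ℕ, if n.Prime ∧ y < n ∧ ((n : ℕ) : ZMod q) = a then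
                ‖∑ i, u i * ((qExpansion 1 ⇑(g i)).coeff n * (n : ℂ) ^ (-(((k : ℂ) - 1) / 2)))‖ ^ 2
                  * (n : ℝ) ^ (-σ) else 0) -
              (q.totient : ℝ)⁻¹ * ∑' n : ℕ, (if n.Prime ∧ y < n then (n : ℝ) ^ (-σ) else 0)|
            ≤ C * ((σ - 1) * Real.log y + 1 / Real.log y) *
                ∑' n : ℕ, (if n.Prime ∧ y < n then (n : ℝ) ^ (-σ) else 0)) :
    BookerThorne2014_levelOne_zeros := by
  refine BookerThorne2014_levelOne_zeros_of_twistedZeros fun k S hS c hpair ↦ ?_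
  refine levelOne_twistedZeros_of_prop8 (fun n hn g hginj hgnew t ↦ ?_) S hS c hpair
  -- Ramanujan at every prime: Deligne (level one, so no prime divides the level)
  have hk : 2 ≤ k := two_le_weight_of_isNewform0 (hgnew ⟨0, hn⟩)
  have hR : ∀ (i : Fin n) (p : ℕ), p.Prime →
      ‖cuspCoeff (g i) p‖ ≤ 2 * (p : ℝ) ^ (((k : ℝ) - 1) / 2) := fun i p hp ↦
    hD.newform_coeff_bound 1 k hk (g i) (hgnew i) p hp hp.not_dvd_one
  -- Lemma 3 at `q = 1`, two-sided form with the constant `max C 0`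
  obtain ⟨C, hC⟩ := hL3 k (Fin n) g hgnew hginj 1
  have hL3' : ∃ C : ℝ, 0 ≤ C ∧ ∀ (y : ℕ), 2 ≤ y → ∀ σ : ℝ, 1 < σ → σ ≤ 2 →
      C / Real.log y ≤ 1 / 4 → C * ((σ - 1) * Real.log y) ≤ 1 / 4 →
      ∀ u : Fin n → ℂ, ∑ i, ‖u i‖ ^ 2 = 1 →
        1 / 2 * (∑' m : ℕ, if m.Prime ∧ y < m then (m : ℝ) ^ (-σ) else 0) ≤
          ∑' m : ℕ, (if m.Prime ∧ y < m then
            ‖∑ i, u i * (cuspCoeff (g i) m * (m : ℂ) ^ (-(((k : ℂ) - 1) / 2)))‖ ^ 2 *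
              (m : ℝ) ^ (-σ) else 0) ∧
        ∑' m : ℕ, (if m.Prime ∧ y < m then
            ‖∑ i, u i * (cuspCoeff (g i) m * (m : ℂ) ^ (-(((k : ℂ) - 1) / 2)))‖ ^ 2 *
              (m : ℝ) ^ (-σ) else 0) ≤
          3 / 2 * (∑' m : ℕ, if m.Prime ∧ y < m then (m : ℝ) ^ (-σ) else 0) := by
    refine ⟨max C 0, le_max_right _ _, fun y hy σ hσ1 hσ2 hlog hσlog u hu ↦ ?_⟩
    have hS0 : 0 ≤ ∑' m : ℕ, (if m.Prime ∧ y < m then (m : ℝ) ^ (-σ) else 0) :=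
      tsum_nonneg fun m ↦ by split_ifs <;> positivity
    have hy1 : (1 : ℝ) < y := by exact_mod_cast lt_of_lt_of_le one_lt_two hy
    have hlogy : 0 < Real.log y := Real.log_pos hy1
    have hε : 0 ≤ (σ - 1) * Real.log y + 1 / Real.log y := by positivity
    have h1 := hC 0 (isUnit_of_subsingleton _) y hy σ hσ1 hσ2 u hu
    -- remove the (empty) congruence condition and `φ(1) = 1`
    have hcong : (∑' m : ℕ, if m.Prime ∧ y < m ∧ ((m : ℕ) : ZMod 1) = 0 then
        ‖∑ i, u i * ((qExpansion 1 ⇑(g i)).coeff m * (m : ℂ) ^ (-(((k : ℂ) - 1) / 2)))‖ ^ 2 *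
          (m : ℝ) ^ (-σ) else 0) =
        ∑' m : ℕ, (if m.Prime ∧ y < m then
          ‖∑ i, u i * (cuspCoeff (g i) m * (m : ℂ) ^ (-(((k : ℂ) - 1) / 2)))‖ ^ 2 *
            (m : ℝ) ^ (-σ) else 0) := by
      refine tsum_congr fun m ↦ ?_
      have hm : ((m : ℕ) : ZMod 1) = 0 := Subsingleton.elim _ _
      simp only [hm, and_true, cuspCoeff]
    rw [hcong, Nat.totient_one, Nat.cast_one, inv_one, one_mul] at h1
    have h2 : C * ((σ - 1) * Real.log y + 1 / Real.log y) ≤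
        max C 0 * ((σ - 1) * Real.log y + 1 / Real.log y) :=
      mul_le_mul_of_nonneg_right (le_max_left _ _) hε
    have h3 : max C 0 * ((σ - 1) * Real.log y + 1 / Real.log y) ≤ 1 / 2 := by
      have : max C 0 * ((σ - 1) * Real.log y + 1 / Real.log y) =
          max C 0 * ((σ - 1) * Real.log y) + max C 0 / Real.log y := by ring
      rw [this]
      linarith
    have h4 := abs_le.1 (h1.trans (mul_le_mul_of_nonneg_right h2 hS0))
    have h5 : max C 0 * ((σ - 1) * Real.log y + 1 / Real.log y) *
        ∑' m : ℕ, (if m.Prime ∧ y < m then (m : ℝ) ^ (-σ) else 0) ≤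
        1 / 2 * ∑' m : ℕ, (if m.Prime ∧ y < m then (m : ℝ) ^ (-σ) else 0) :=
      mul_le_mul_of_nonneg_right h3 hS0
    constructor
    · nlinarith [h4.1, h5]
    · nlinarith [h4.2, h5]
  obtain ⟨η, hη, h⟩ := exists_twist_eq_exp_target hn g hgnew hR hL3' t
  exact ⟨η, hη, fun σ hσ1 hσ2 ↦ by
    obtain ⟨e, he, -, hLe⟩ := h σ hσ1 hσ2
    exact ⟨e, he, hLe⟩⟩

end Final

end Literature.Barriers.RiemannHypothesis
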